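import Summits.MatrixMultiplication.OmegaCensus.STPP211Z2pow6DirectChunks

/-!
# (2,1,1)¹⁰ ⊄ (ℤ/2)⁶ — part S2 class 09, decisions 4/7: direct search over the hard class #23 of `reps29` (roots d = 59 (part))

Cell `pub-omega` (unit `pub-omega-stpp-1-g37`), topic `Summits/MatrixMultiplication/OmegaCensus`.
HONEST FRAMING (verbatim): lottery ticket; floor = certified bounds/negative ranges. Census STRUCTURE bookkeeping (B5, `T1((ℤ/2)⁶)`, Pb237);
nothing here is a bound on `ω`.

Class #23 of `reps29` in the translated form `C' = hc09 = [0, 4, 5, 6, 12, 20, 31, 36, 47, 55]` (`+ 4`, block of `c = 4` first; linear stabilizer of order 144,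
root representatives [1, 7, 8, 11, 13, 56, 59, 60, 61]; HOME `pub-omega-stpp-1-g36/code/hard_perd.json`). The kernel evaluates the direct engine
(`STPP211Z2pow6DirectEngine.rootD`, soundness `noNF_of_rootD`) in CHUNKS of the root node (`STPP211Z2pow6DirectChunks.rootDX`, ≤ 10⁵ search
calls each, exact counts from the seat's C mirror `godc.c`; this file: 817,821 calls) and assembles `rootD C' d = true` per root by
`rootD_of_chunks`. The class theorem follows in `STPP211Z2pow6Hard09Class` (symmetry transport, `STPP211Z2pow6DirectTransport`).

References: H. Cohn, R. Kleinberg, B. Szegedy, C. Umans, FOCS 2005 (arXiv:math/0511460), Def. 5.1.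
-/

namespace Summit.MatrixMultiplication.OmegaCensus

namespace T1CosetEng

/-- KERNEL: root `d = 59`, chunk 1 (codes `x = 0 … 3` of the branching label's lane; 73,791 search calls). -/
theorem hc09_d59_c1 : rootDX [0, 4, 5, 6, 12, 20, 31, 36, 47, 55] 59 15 = true := by decide +kernel

/-- KERNEL: root `d = 59`, chunk 2 (codes `x = 4 … 7` of the branching label's lane; 76,934 search calls). -/
theorem hc09_d59_c2 : rootDX [0, 4, 5, 6, 12, 20, 31, 36, 47, 55] 59 240 = true := by decide +kernel

/-- KERNEL: root `d = 59`, chunk 3 (codes `x = 8 … 9` of the branching label's lane; 90,783 search calls). -/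
theorem hc09_d59_c3 : rootDX [0, 4, 5, 6, 12, 20, 31, 36, 47, 55] 59 768 = true := by decide +kernel

/-- KERNEL: root `d = 59`, chunk 4 (codes `x = 10 … 10` of the branching label's lane; 85,569 search calls). -/
theorem hc09_d59_c4 : rootDX [0, 4, 5, 6, 12, 20, 31, 36, 47, 55] 59 1024 = true := by decide +kernel

/-- KERNEL: root `d = 59`, chunk 5 (codes `x = 11 … 11` of the branching label's lane; 123,690 search calls). -/
theorem hc09_d59_c5 : rootDX [0, 4, 5, 6, 12, 20, 31, 36, 47, 55] 59 2048 = true := by decide +kernel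

/-- KERNEL: root `d = 59`, chunk 6 (codes `x = 12 … 13` of the branching label's lane; 86,294 search calls). -/
theorem hc09_d59_c6 : rootDX [0, 4, 5, 6, 12, 20, 31, 36, 47, 55] 59 12288 = true := by decide +kernel

/-- KERNEL: root `d = 59`, chunk 7 (codes `x = 14 … 14` of the branching label's lane; 83,786 search calls). -/
theorem hc09_d59_c7 : rootDX [0, 4, 5, 6, 12, 20, 31, 36, 47, 55] 59 16384 = true := by decide +kernel

/-- KERNEL: root `d = 59`, chunk 8 (codes `x = 15 … 15` of the branching label's lane; 119,724 search calls). -/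
theorem hc09_d59_c8 : rootDX [0, 4, 5, 6, 12, 20, 31, 36, 47, 55] 59 32768 = true := by decide +kernel

/-- KERNEL: root `d = 59`, chunk 9 (codes `x = 16 … 17` of the branching label's lane; 77,250 search calls). -/
theorem hc09_d59_c9 : rootDX [0, 4, 5, 6, 12, 20, 31, 36, 47, 55] 59 196608 = true := by decide +kernel

end T1CosetEng

end Summit.MatrixMultiplication.OmegaCensus
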